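import Mathlib.Analysis.Complex.Polynomial.Basic
import Mathlib.FieldTheory.IsAlgClosed.AlgebraicClosure
import Literature.RingTheory.MvPolynomial.GeomComponentsFewBranches
import HarnessLib

/-!
# LangWeilTransfer — crux `ShatteringExclusion` (stmt-ValiantsHypothesis-6372), line `birth` v2:
# stub `stub_fewBranchesDescent` (Galois descent from a low-degree point with few branches)

Route `ValiantsHypothesis/LangWeilTransfer`, crux `ShatteringExclusion` (SE), registered line
`Cruxes/ShatteringExclusion/Lines/birth.lean` (v2). The line certifies a tame component of the
constants variety of a near-optimal circuit for `per_n` by a POINT: constants in a number field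
`K` of polynomial degree (`stub_lowDegreeConstants`, open-problem grade) whose constant vector `y`
lies on polynomially many geometric components of the complexified constants variety
(`stub_fewBranches`, conjecture grade — the v2 replacement of the v1 bet `stub_unibranching`,
"exactly one component"). The present file is the third, PROVABLE stub, the commutative algebra
turning that point certificate into the conclusion of SE:

* `stub_fewBranchesDescent` — for `I ⊆ ℚ[Y_1..Y_m]`, `ℚ ⊆ K ⊆ ℂ` of finite degree `≤ B`,
  `y ∈ K^m`, if the set of minimal primes of `I·ℂ[Y]` below `𝔪_y = ker (ev_y)` (the irreducible
  components of `V_ℂ(I)` through `y`) is nonempty of size `≤ B'`, then some minimal prime `𝔭`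
  of `I` has `0 < #minprimes(𝔭·ℚ̄[Y]) ≤ B · B'`.

Proof (Stacks Project 04KZ, orbit–stabiliser without uniqueness, tree lemma
`Literature.RingTheory.MvPolynomial.exists_mem_minimalPrimes_ncard_map_le_finrank_mul`): embed
`ℚ̄ ↪ ℂ`; `y = ι ∘ y'` with `y' ∈ ℚ̄^m`; the components through `y` over `ℂ` and through `y'`
over `ℚ̄` correspond (`…ncard_branches_map_of_isAlgClosed`); for a component `W = V(Q)` through
`y'`, `𝔭 := Q ∩ ℚ[Y]` is a minimal prime of `I` whose geometric components form the Galois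
orbit of `W`, and `g ↦ gW` factors through `(g|_E, h W)` with `E = ℚ(y')` (`[E:ℚ] ≤ [K:ℚ] ≤ B`)
and `h = g_ψ⁻¹ g ∈ Stab(y')`, `hW` a component through `y'`: at most `B · B'` conjugates.
The v1 stub `stub_componentDescent` (`…ComponentDescent.lean`, p572771) is the case `B' = 1`.

Honest framing: this closes a PROVABLE stub of the line only; `stub_lowDegreeConstants`,
`stub_fewBranches`, the crux SE and the route `LangWeilTransfer` stay open / conditional, and
VP ≠ VNP is NOT proved here.
-/

noncomputable section

open MvPolynomial

-- the summit and the problem share the name `ValiantsHypothesis` (D-0017 single-conjunct layout)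
set_option linter.dupNamespace false

namespace Summit.ValiantsHypothesis.ValiantsHypothesis.Theorems.LangWeilTransfer.ShatteringExclusion

/-- An element of `ℂ` algebraic over `ℚ` lies in the image of any `ℚ`-embedding `ℚ̄ → ℂ`.
[folklore] -/
private theorem mem_range_of_isIntegral' (ι : AlgebraicClosure ℚ →ₐ[ℚ] ℂ) {x : ℂ}
    (hx : IsIntegral ℚ x) : x ∈ Set.range ι := by
  have hsplit : ((minpoly ℚ x).map (algebraMap ℚ (AlgebraicClosure ℚ))).Splits :=
    IsAlgClosed.splits _
  have hroot : x ∈ (minpoly ℚ x).rootSet ℂ :=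
    Polynomial.mem_rootSet.2 ⟨minpoly.ne_zero hx, minpoly.aeval ℚ x⟩
  rw [← hsplit.image_rootSet ι] at hroot
  obtain ⟨z, -, hz⟩ := hroot
  exact ⟨z, hz⟩

/-- **Stub `FewBranchesDescent` — Galois descent from a low-degree point with few branches**
(registered obligation `stub_fewBranchesDescent` of crux `ShatteringExclusion`, line `birth` v2;
signature verbatim): for an ideal `I ⊆ ℚ[Y_1..Y_m]`, an intermediate field `ℚ ⊆ K ⊆ ℂ` of finite
degree `≤ B`, and a point `y ∈ K^m` through which pass at least one and at most `B'` irreducible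
components of `V_ℂ(I)` (minimal primes of `I·ℂ[Y]` below `ker (ev_y)`), some minimal prime
`𝔭 ⊇ I` has `0 < #minprimes(𝔭·ℚ̄[Y]) ≤ B · B'` (the `ℚ`-closure of a component through `y` has at
most `[ℚ(y):ℚ] · #branches(y)` geometric components). [cite: StacksProject, Tag 04KZ] -/
theorem stub_fewBranchesDescent :
    ∀ (m B B' : ℕ) (I : Ideal (MvPolynomial (Fin m) ℚ)) (y : Fin m → ℂ) (K : IntermediateField ℚ ℂ),
      FiniteDimensional ℚ K → Module.finrank ℚ K ≤ B → (∀ v, y v ∈ K) →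
        0 < {𝔓 : Ideal (MvPolynomial (Fin m) ℂ) |
              𝔓 ∈ (I.map (MvPolynomial.map (algebraMap ℚ ℂ))).minimalPrimes ∧
                𝔓 ≤ RingHom.ker (MvPolynomial.aeval y : MvPolynomial (Fin m) ℂ →ₐ[ℂ] ℂ)}.ncard →
        {𝔓 : Ideal (MvPolynomial (Fin m) ℂ) |
              𝔓 ∈ (I.map (MvPolynomial.map (algebraMap ℚ ℂ))).minimalPrimes ∧
                𝔓 ≤ RingHom.ker (MvPolynomial.aeval y : MvPolynomial (Fin m) ℂ →ₐ[ℂ] ℂ)}.ncard ≤ B' →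
          ∃ 𝔭 ∈ I.minimalPrimes,
            0 < ((Ideal.map (MvPolynomial.map (algebraMap ℚ (AlgebraicClosure ℚ))) 𝔭).minimalPrimes).ncard ∧
              ((Ideal.map (MvPolynomial.map (algebraMap ℚ (AlgebraicClosure ℚ))) 𝔭).minimalPrimes).ncard ≤
                B * B' := by
  intro m B B' I y K hKfd hKB hyK hpos hle
  haveI := hKfd
  -- `ℚ̄/ℚ` is Galois for the ambient `ℚ`-algebra structure (`DivisionRing.toRatAlgebra`); Mathlib's
  -- instance is stated for `AlgebraicClosure.instAlgebra` (definitionally, not reducibly, equal).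
  haveI : IsGalois ℚ (AlgebraicClosure ℚ) :=
    @IsAlgClosure.isGalois ℚ (AlgebraicClosure ℚ) _ _ (AlgebraicClosure.instAlgebra ℚ) inferInstance
      inferInstance
  -- embed `ℚ̄` into `ℂ` over `ℚ`, as an algebra structure
  let ι : AlgebraicClosure ℚ →ₐ[ℚ] ℂ := IsAlgClosed.lift
  letI : Algebra (AlgebraicClosure ℚ) ℂ := ι.toRingHom.toAlgebra
  have hιalg : algebraMap (AlgebraicClosure ℚ) ℂ = (ι : AlgebraicClosure ℚ →+* ℂ) := rfl
  haveI : IsScalarTower ℚ (AlgebraicClosure ℚ) ℂ :=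
    IsScalarTower.of_algebraMap_eq fun x => by rw [hιalg]; exact (ι.commutes x).symm
  -- the coordinates of `y` are algebraic, hence images of points of `ℚ̄`
  have hyint : ∀ v, IsIntegral ℚ (y v) := fun v =>
    (Algebra.IsIntegral.isIntegral (R := ℚ) (⟨y v, hyK v⟩ : K)).map K.val
  have hyrange : ∀ v, ∃ z : AlgebraicClosure ℚ, ι z = y v := fun v =>
    mem_range_of_isIntegral' ι (hyint v)
  choose y' hy' using hyrange
  have hy : (algebraMap (AlgebraicClosure ℚ) ℂ) ∘ y' = y := funext fun v => by
    rw [Function.comp_apply, hιalg]; exact hy' v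
  -- `I ℂ[Y] = (I ℚ̄[Y]) ℂ[Y]`
  have hI : I.map (MvPolynomial.map (algebraMap ℚ ℂ)) =
      (I.map (MvPolynomial.map (algebraMap ℚ (AlgebraicClosure ℚ)))).map
        (MvPolynomial.map (algebraMap (AlgebraicClosure ℚ) ℂ)) := by
    rw [Ideal.map_map]
    congr 1
    refine RingHom.ext fun p => ?_
    rw [RingHom.comp_apply, MvPolynomial.map_map, ← IsScalarTower.algebraMap_eq]
  -- the branches through `y` over `ℂ` are the branches through `y'` over `ℚ̄`
  rw [hI, ← hy, Literature.RingTheory.MvPolynomial.ncard_branches_map_of_isAlgClosed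
    (I.map (MvPolynomial.map (algebraMap ℚ (AlgebraicClosure ℚ)))) y'] at hpos hle
  obtain ⟨Q, hQ, hQy'⟩ := Set.nonempty_of_ncard_ne_zero hpos.ne'
  -- the number field generated by `y'`, of degree `≤ [K:ℚ] ≤ B`
  let E : IntermediateField ℚ (AlgebraicClosure ℚ) := IntermediateField.adjoin ℚ (Set.range y')
  haveI : FiniteDimensional ℚ E :=
    IntermediateField.finiteDimensional_adjoin fun x _ => Algebra.IsIntegral.isIntegral x
  have hyE : ∀ v, y' v ∈ E := fun v => IntermediateField.subset_adjoin ℚ _ ⟨v, rfl⟩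
  have hEK : Module.finrank ℚ E ≤ B := by
    have h1 : Module.finrank ℚ E = Module.finrank ℚ (E.map ι) :=
      (IntermediateField.equivMap E ι).toLinearEquiv.finrank_eq
    have h2 : E.map ι ≤ K := by
      rw [IntermediateField.adjoin_map, IntermediateField.adjoin_le_iff]
      rintro _ ⟨_, ⟨v, rfl⟩, rfl⟩
      rw [hy' v]
      exact hyK v
    rw [h1]
    exact (IntermediateField.finrank_le_of_le_right h2).trans hKB
  obtain ⟨𝔭, h𝔭, hpos', hle'⟩ :=
    Literature.RingTheory.MvPolynomial.exists_mem_minimalPrimes_ncard_map_le_finrank_mul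
      I y' E hyE hQ hQy'
  exact ⟨𝔭, h𝔭, hpos', hle'.trans (Nat.mul_le_mul hEK hle)⟩

end Summit.ValiantsHypothesis.ValiantsHypothesis.Theorems.LangWeilTransfer.ShatteringExclusion

end
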